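import Literature.Analysis.FunctionSpaces.TorusAxisJackson
import Literature.Analysis.FunctionSpaces.TorusAnalyticSeminorm
import HarnessLib

/-!
# Jackson's inequality on the cube: distance of an analytic / smooth field to cube-band-limited trigonometric polynomials

Analysis/FunctionSpaces proof file (everything proved; no definitions, no named facts).  Sequel of `TorusAxisJackson`.  With the axis
band-limiting polynomials `Ψᵢ^{[r]} = 1 − (1 − Ψᵢ)^r` (multipliers `mᵢ(k) = 1 − (1 − stepSym K Δ (kᵢ))^r`, support `|kᵢ| ≤ K+2Δ`,
`L^∞`-bound `1 + (1+C_κ)^r`, `C_κ = 4 + (2K+2Δ+1)π/Δ`) the product `Π_i Ψᵢ^{[r]}` maps any real trigonometric polynomial `P` to one with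
frequencies in the CUBE `‖k‖_∞ ≤ K + 2Δ`, and telescoping over the axes with the iterated axis Jackson inequality gives

* `norm_realTrigPoly_sub_stepPolyOn_le` — `‖P − Π_{i∈s} Ψᵢ^{[r]} P‖_∞ ≤ |s| (1+(1+C_κ)^r)^{|s|} (2/Δ)^r maxᵢ ‖∂ᵢ^r P‖_∞`;
* `exists_realTrigPoly_cubeSupp_near_realTrigPoly` — hence `dist_∞(P, realTrigPoly (cubeSupp (K+2Δ)) ·) ≤ d (1+(1+C_κ)^r)^d (2/Δ)^r maxᵢ ‖∂ᵢ^r P‖_∞`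
  with a conjugate-symmetric coefficient family;
* `exists_realTrigPoly_cubeSupp_near_of_isSmooth` — the same for every SMOOTH field `g` (sharp truncations `fourierTruncate N g → g` and
  `→ ∂ᵢ^r g` uniformly; the constant is untouched), for every `W` exceeding the bound;
* `norm_iterate_partialDeriv_le_of_dnorm_le` — the read-out `‖∂ᵢ^r g‖_∞ ≤ M r! R^r` from the Armstrong–Vicol seminorm `⟦g⟧_{r,R} ≤ M`.

Choosing `r ≈ Δ/(C R)` turns `(2/Δ)^r r! R^r` into `e^{−Δ/(CR)}`: an analytic field with radius parameter `R` is within `C M e^{−Δ/(CR)}` of the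
cube-band-limited polynomials at scale `Δ` — with NO power of `Δ`, `K` or `R` in front (cell note F-k3l-8).  Consumer: the best-approximation
form of the descent ladder (`TorusCubeDescentRungFluxApprox`, `PassiveVectorTensorCubeDescentApprox`, …) for `stub_effectiveFrameEnergyL_bandKill`,
K1L_D `stmt-AnomalousDissipation-27980`.
## Mathlib / tree search
Tree: `TorusAxisJackson`, `TorusCubeCutoffCommutator` (`cubeSupp`, `mem_cubeSupp`, `IsConjSymm.real_weight`), `TorusCubeFluxLocalisation.realTrigPoly_eq_of_vanish`,
`TorusFourierSeries` (`norm_sub_fourierTruncate_apply_le`, `summable_norm_mFourierCoeff_of_isSmooth`), `TorusTrigPoly` (`mFourierCoeff_complexify_partialDeriv`,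
`fourierTruncate_eq`), `TorusAnalyticSeminorm` (`dnorm`, `norm_iterPartialDeriv_le_of_dnorm_le`).  Mathlib: `tendsto_tsum_compl_atTop_zero`, `Finset.prod_insert`.
## References
* R. A. DeVore, G. G. Lorentz, *Constructive Approximation* (1993), Ch. 7 §2. [`DeVoreLorentz1993`]
* L. Grafakos, *Classical Fourier Analysis* (3rd ed., 2014), §3.1.3. [`Grafakos2014`]
* S. Armstrong, V. Vicol, *Anomalous diffusion by fractal homogenization*, Ann. PDE 11 (2025), App. A (A.1). [`ArmstrongVicol2025`] -/

noncomputable section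

open MeasureTheory Set Filter Complex UnitAddTorus Function Finset
open scoped ENNReal InnerProductSpace ComplexConjugate Topology

namespace Literature.Analysis.FunctionSpaces
namespace Torus

variable {d : Type*} [Fintype d] [DecidableEq d]

/-! ## §1 The multi-axis band-limiting weight and its `L^∞` bound -/

section MultiAxis

open EuclideanSpace

/-- **`L^∞` bound of `Π_{i∈s} Ψᵢ^{[r]}`**: `‖Π_{i∈s} Ψᵢ^{[r]} P‖_∞ ≤ (1 + (1+C_κ)^r)^{|s|} ‖P‖_∞`, `C_κ = 4 + (2K+2Δ+1)π/Δ`.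
[cite: Grafakos2014, §3.1.3] -/
theorem norm_realTrigPoly_stepPolyOn_le (K : ℕ) {Δ : ℕ} (hΔ : 0 < Δ) (S : Finset (d → ℤ)) (r : ℕ) (s : Finset d) :
    ∀ (c : (d → ℤ) → EuclideanSpace ℂ d) {B : ℝ}, (∀ z, ‖realTrigPoly S c z‖ ≤ B) →
      ∀ x, ‖realTrigPoly S (fun k => ((∏ i ∈ s, (1 - (1 - stepSym K Δ (k i)) ^ r) : ℝ) : ℂ) • c k) x‖ ≤
        (1 + (1 + (4 + (2 * (K + Δ) + 1) * Real.pi / Δ)) ^ r) ^ s.card * B := by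
  classical
  induction s using Finset.induction_on with
  | empty =>
    intro c B hB x
    have : (fun k : d → ℤ => ((∏ i ∈ (∅ : Finset d), (1 - (1 - stepSym K Δ (k i)) ^ r) : ℝ) : ℂ) • c k) = c := by
      funext k; simp
    rw [this, Finset.card_empty, pow_zero, one_mul]; exact hB x
  | insert a s ha ih =>
    intro c B hB x
    have hB0 : 0 ≤ B := (norm_nonneg _).trans (hB x)
    set c' : (d → ℤ) → EuclideanSpace ℂ d := fun k => ((∏ i ∈ s, (1 - (1 - stepSym K Δ (k i)) ^ r) : ℝ) : ℂ) • c k with hc'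
    have hsplit : (fun k : d → ℤ => ((∏ i ∈ insert a s, (1 - (1 - stepSym K Δ (k i)) ^ r) : ℝ) : ℂ) • c k) =
        fun k => ((1 - (1 - stepSym K Δ (k a)) ^ r : ℝ) : ℂ) • c' k := by
      funext k; rw [Finset.prod_insert ha, hc']; dsimp only; rw [smul_smul, ← Complex.ofReal_mul, mul_comm]
    rw [hsplit]
    have h1 : ∀ z, ‖realTrigPoly S c' z‖ ≤ (1 + (1 + (4 + (2 * (K + Δ) + 1) * Real.pi / Δ)) ^ r) ^ s.card * B :=
      fun z => ih c hB z
    have h2 := norm_realTrigPoly_stepPoly_le a K Δ S r c' h1 x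
    have hC : (1 + ∫ y : UnitAddTorus d, |stepKernel a K Δ y|) ^ r ≤ (1 + (4 + (2 * (K + Δ) + 1) * Real.pi / Δ)) ^ r :=
      pow_le_pow_left₀ (by positivity) (by linarith [integral_abs_stepKernel_le (d := d) a K hΔ]) r
    rw [Finset.card_insert_of_notMem ha, pow_succ]
    calc ‖realTrigPoly S (fun k => ((1 - (1 - stepSym K Δ (k a)) ^ r : ℝ) : ℂ) • c' k) x‖
        ≤ (1 + (1 + ∫ y : UnitAddTorus d, |stepKernel a K Δ y|) ^ r) *
            ((1 + (1 + (4 + (2 * (K + Δ) + 1) * Real.pi / Δ)) ^ r) ^ s.card * B) := h2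
      _ ≤ (1 + (1 + (4 + (2 * (K + Δ) + 1) * Real.pi / Δ)) ^ r) *
            ((1 + (1 + (4 + (2 * (K + Δ) + 1) * Real.pi / Δ)) ^ r) ^ s.card * B) :=
          mul_le_mul_of_nonneg_right (by linarith) (by positivity)
      _ = _ := by ring

/-- **Multi-axis Jackson by telescoping**: `‖P − Π_{i∈s} Ψᵢ^{[r]} P‖_∞ ≤ |s| (1+(1+C_κ)^r)^{|s|} (2/Δ)^r maxᵢ ‖∂ᵢ^r P‖_∞`.
[cite: DeVoreLorentz1993, Ch. 7 §2] -/
theorem norm_realTrigPoly_sub_stepPolyOn_le (K : ℕ) {Δ : ℕ} (hΔ : 0 < Δ) (S : Finset (d → ℤ)) (r : ℕ)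
    (c : (d → ℤ) → EuclideanSpace ℂ d) {D : ℝ}
    (hD : ∀ i z, ‖realTrigPoly S (fun k => (2 * Real.pi * Complex.I * (k i)) ^ r • c k) z‖ ≤ D) (s : Finset d) :
    ∀ x, ‖realTrigPoly S c x - realTrigPoly S (fun k => ((∏ i ∈ s, (1 - (1 - stepSym K Δ (k i)) ^ r) : ℝ) : ℂ) • c k) x‖ ≤
      s.card * (1 + (1 + (4 + (2 * (K + Δ) + 1) * Real.pi / Δ)) ^ r) ^ s.card * (2 / Δ) ^ r * D := by
  classical
  set A : ℝ := 1 + (1 + (4 + (2 * (K + Δ) + 1) * Real.pi / Δ)) ^ r with hA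
  have hA1 : 1 ≤ A := by
    have h0 : 0 ≤ (1 + (4 + (2 * ((K : ℝ) + Δ) + 1) * Real.pi / Δ)) ^ r := by positivity
    rw [hA]; linarith
  induction s using Finset.induction_on with
  | empty =>
    intro x
    have : (fun k : d → ℤ => ((∏ i ∈ (∅ : Finset d), (1 - (1 - stepSym K Δ (k i)) ^ r) : ℝ) : ℂ) • c k) = c := by
      funext k; simp
    rw [this, sub_self, norm_zero]; simp
  | insert a s ha ih =>
    intro x
    have hDx : 0 ≤ D := (norm_nonneg _).trans (hD a x)
    -- `P − M_{s∪a} P = (P − M_s P) + M_s (P − m_a P)`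
    set e : (d → ℤ) → EuclideanSpace ℂ d := fun k => (((1 - stepSym K Δ (k a)) ^ r : ℝ) : ℂ) • c k with he
    have hsplit : realTrigPoly S c x -
        realTrigPoly S (fun k => ((∏ i ∈ insert a s, (1 - (1 - stepSym K Δ (k i)) ^ r) : ℝ) : ℂ) • c k) x =
        (realTrigPoly S c x - realTrigPoly S (fun k => ((∏ i ∈ s, (1 - (1 - stepSym K Δ (k i)) ^ r) : ℝ) : ℂ) • c k) x) +
          realTrigPoly S (fun k => ((∏ i ∈ s, (1 - (1 - stepSym K Δ (k i)) ^ r) : ℝ) : ℂ) • e k) x := by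
      have h3 : realTrigPoly S (fun k => ((∏ i ∈ insert a s, (1 - (1 - stepSym K Δ (k i)) ^ r) : ℝ) : ℂ) • c k) =
          realTrigPoly S (fun k => ((∏ i ∈ s, (1 - (1 - stepSym K Δ (k i)) ^ r) : ℝ) : ℂ) • c k) -
            realTrigPoly S (fun k => ((∏ i ∈ s, (1 - (1 - stepSym K Δ (k i)) ^ r) : ℝ) : ℂ) • e k) := by
        rw [← realTrigPoly_sub]
        refine realTrigPoly_congr fun k _ => ?_
        simp only [Pi.sub_apply, he, smul_smul, ← sub_smul]
        congr 1
        rw [Finset.prod_insert ha]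
        push_cast
        ring
      rw [h3, Pi.sub_apply]
      abel
    rw [hsplit]
    -- the new piece: `M_s (E_a^r P)`, with `‖E_a^r P‖_∞ ≤ (2/Δ)^r D`
    have hE : ∀ z, ‖realTrigPoly S e z‖ ≤ (2 / Δ) ^ r * D := fun z =>
      norm_realTrigPoly_oneSubStep_pow_le a K hΔ S r c (hD a) z
    have hM := norm_realTrigPoly_stepPolyOn_le K hΔ S r s e hE x
    have hih := ih x
    rw [Finset.card_insert_of_notMem ha]
    have hAs : 0 ≤ A ^ s.card := by positivity
    have hpow : A ^ s.card ≤ A ^ (s.card + 1) := by rw [pow_succ]; exact le_mul_of_one_le_right hAs hA1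
    calc ‖realTrigPoly S c x - realTrigPoly S (fun k => ((∏ i ∈ s, (1 - (1 - stepSym K Δ (k i)) ^ r) : ℝ) : ℂ) • c k) x +
          realTrigPoly S (fun k => ((∏ i ∈ s, (1 - (1 - stepSym K Δ (k i)) ^ r) : ℝ) : ℂ) • e k) x‖
        ≤ s.card * A ^ s.card * (2 / Δ) ^ r * D + A ^ s.card * ((2 / Δ) ^ r * D) := (norm_add_le _ _).trans (add_le_add hih hM)
      _ ≤ s.card * A ^ (s.card + 1) * (2 / Δ) ^ r * D + A ^ (s.card + 1) * ((2 / Δ) ^ r * D) := by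
          have h0 : 0 ≤ (2 / (Δ : ℝ)) ^ r * D := by positivity
          have := mul_le_mul_of_nonneg_right hpow h0
          have := mul_le_mul_of_nonneg_left (mul_le_mul_of_nonneg_right hpow h0) (Nat.cast_nonneg s.card)
          nlinarith
      _ = ((s.card + 1 : ℕ) : ℝ) * A ^ (s.card + 1) * (2 / Δ) ^ r * D := by push_cast; ring

/-- **Cube Jackson for real trigonometric polynomials**: for `P = realTrigPoly S c` with `S` symmetric and `c` conjugate-symmetric there is a
conjugate-symmetric coefficient family `t` on the cube `‖k‖_∞ ≤ K + 2Δ` with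
`‖P − realTrigPoly (cubeSupp (K+2Δ)) t‖_∞ ≤ d (1+(1+C_κ)^r)^d (2/Δ)^r maxᵢ ‖∂ᵢ^r P‖_∞`. [cite: DeVoreLorentz1993, Ch. 7 §2] -/
theorem exists_realTrigPoly_cubeSupp_near_realTrigPoly (K : ℕ) {Δ : ℕ} (hΔ : 0 < Δ) {S : Finset (d → ℤ)}
    (hS : ∀ k ∈ S, -k ∈ S) {c : (d → ℤ) → EuclideanSpace ℂ d} (hc : IsConjSymm c) (r : ℕ) {D : ℝ}
    (hD : ∀ i z, ‖realTrigPoly S (fun k => (2 * Real.pi * Complex.I * (k i)) ^ r • c k) z‖ ≤ D) :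
    ∃ t : (d → ℤ) → EuclideanSpace ℂ d, IsConjSymm t ∧
      ∀ x, ‖realTrigPoly S c x - realTrigPoly (cubeSupp d (K + 2 * Δ)) t x‖ ≤
        Fintype.card d * (1 + (1 + (4 + (2 * (K + Δ) + 1) * Real.pi / Δ)) ^ r) ^ Fintype.card d * (2 / Δ) ^ r * D := by
  classical
  set M : (d → ℤ) → ℝ := fun k => ∏ i ∈ (Finset.univ : Finset d), (1 - (1 - stepSym K Δ (k i)) ^ r) with hM
  set t : (d → ℤ) → EuclideanSpace ℂ d := fun k => if k ∈ S then ((M k : ℝ) : ℂ) • c k else 0 with ht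
  have hMev : ∀ k, M (-k) = M k := fun k => by simp only [hM, Pi.neg_apply, stepSym_neg]
  have hMzero : ∀ k : d → ℤ, k ∉ cubeSupp d (K + 2 * Δ) → M k = 0 := by
    intro k hk
    rw [mem_cubeSupp, not_forall] at hk
    obtain ⟨i, hi⟩ := hk
    rw [not_le] at hi
    have h0 : stepSym K Δ (k i) = 0 := stepSym_eq_zero (by exact_mod_cast hi)
    exact Finset.prod_eq_zero (Finset.mem_univ i) (by rw [h0]; simp)
  refine ⟨t, ?_, fun x => ?_⟩
  · intro k
    by_cases hk : k ∈ S
    · have hk' : -k ∈ S := hS k hk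
      simp only [ht, if_pos hk, if_pos hk']
      exact (hc.real_weight hMev) k
    · have hk' : -k ∉ S := fun h => hk (by simpa using hS (-k) h)
      simp only [ht, if_neg hk, if_neg hk']
      ext j; simp [EuclideanSpace.conjVec]
  · have e1 : realTrigPoly S (fun k => ((M k : ℝ) : ℂ) • c k) = realTrigPoly S t :=
      realTrigPoly_congr fun k hk => by simp only [ht, if_pos hk]
    have e2 : realTrigPoly S t = realTrigPoly (cubeSupp d (K + 2 * Δ)) t := by
      refine realTrigPoly_eq_of_vanish (fun k hk hk' => ?_) (fun k _ hk => ?_)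
      · simp only [ht, if_pos hk, hMzero k hk']; simp
      · simp only [ht, if_neg hk]
    rw [← e2, ← e1]
    simpa [hM] using norm_realTrigPoly_sub_stepPolyOn_le K hΔ S r c hD Finset.univ x

end MultiAxis

/-! ## §2 Smooth fields: sharp truncations converge, the constant is untouched -/

section Smooth

open EuclideanSpace

/-- Iterated partial derivatives of a smooth field are smooth. [cite: Grafakos2014, Prop. 3.2.5] -/
theorem isSmooth_iterate_partialDeriv {g : UnitAddTorus d → EuclideanSpace ℝ d} (hg : IsSmooth g) (i : d) (r : ℕ) :
    IsSmooth ((partialDeriv i)^[r] g) := by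
  induction r with
  | zero => simpa using hg
  | succ r ih => rw [Function.iterate_succ_apply']; exact ih.partialDeriv i

/-- Fourier coefficients of an iterated axis derivative: `𝓕(∂ᵢ^r g)(k) = (2πi kᵢ)^r 𝓕g(k)`. [cite: Grafakos2014, Prop. 3.2.5] -/
theorem mFourierCoeff_complexify_iterate_partialDeriv {g : UnitAddTorus d → EuclideanSpace ℝ d} (hg : IsSmooth g) (i : d) (r : ℕ)
    (k : d → ℤ) :
    mFourierCoeff (EuclideanSpace.complexify ∘ (partialDeriv i)^[r] g) k =
      (2 * Real.pi * Complex.I * (k i)) ^ r • mFourierCoeff (EuclideanSpace.complexify ∘ g) k := by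
  induction r with
  | zero => simp
  | succ r ih =>
    rw [Function.iterate_succ_apply', mFourierCoeff_complexify_partialDeriv (isSmooth_iterate_partialDeriv hg i r), ih, smul_smul, pow_succ,
      mul_comm]

/-- The sharp truncation of a smooth field differentiates termwise: `∂ᵢ^r (P_N g) = P_N (∂ᵢ^r g)` as trigonometric polynomials.
[cite: Grafakos2014, Prop. 3.2.5] -/
theorem realTrigPoly_deriv_coeff_eq_fourierTruncate_iterate {g : UnitAddTorus d → EuclideanSpace ℝ d} (hg : IsSmooth g) (i : d)
    (r N : ℕ) :
    realTrigPoly (freqBall N) (fun k => (2 * Real.pi * Complex.I * (k i)) ^ r • mFourierCoeff (EuclideanSpace.complexify ∘ g) k) =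
      fourierTruncate N ((partialDeriv i)^[r] g) := by
  rw [fourierTruncate_eq]
  exact realTrigPoly_congr fun k _ => (mFourierCoeff_complexify_iterate_partialDeriv hg i r k).symm

/-- The sup-norm tail bound of the sharp truncations tends to zero. [cite: Grafakos2014, Prop. 3.2.5] -/
theorem tendsto_tsum_compl_freqBall_norm_mFourierCoeff (g : UnitAddTorus d → EuclideanSpace ℝ d) :
    Tendsto (fun N : ℕ => ∑' k : {k // k ∉ freqBall (d := d) N}, ‖mFourierCoeff (EuclideanSpace.complexify ∘ g) k‖) atTop (𝓝 0) :=
  (tendsto_tsum_compl_atTop_zero fun k : d → ℤ => ‖mFourierCoeff (EuclideanSpace.complexify ∘ g) k‖).comp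
    (tendsto_freqBall_atTop (d := d))

/-- **CUBE JACKSON FOR SMOOTH FIELDS**: if `‖∂ᵢ^r g‖_∞ ≤ D` for all axes, then for every `W` exceeding
`d (1+(1+C_κ)^r)^d (2/Δ)^r D` there is a conjugate-symmetric `t` on the cube `‖k‖_∞ ≤ K + 2Δ` with `‖g − realTrigPoly (cubeSupp (K+2Δ)) t‖_∞ ≤ W`.
[cite: DeVoreLorentz1993, Ch. 7 §2] -/
theorem exists_realTrigPoly_cubeSupp_near_of_isSmooth (K : ℕ) {Δ : ℕ} (hΔ : 0 < Δ) {g : UnitAddTorus d → EuclideanSpace ℝ d}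
    (hg : IsSmooth g) (r : ℕ) {D : ℝ} (hD : ∀ i z, ‖((partialDeriv i)^[r] g) z‖ ≤ D) {W : ℝ}
    (hW : Fintype.card d * (1 + (1 + (4 + (2 * (K + Δ) + 1) * Real.pi / Δ)) ^ r) ^ Fintype.card d * (2 / Δ) ^ r * D < W) :
    ∃ t : (d → ℤ) → EuclideanSpace ℂ d, IsConjSymm t ∧ ∀ x, ‖g x - realTrigPoly (cubeSupp d (K + 2 * Δ)) t x‖ ≤ W := by
  classical
  set A : ℝ := Fintype.card d * (1 + (1 + (4 + (2 * (K + Δ) + 1) * Real.pi / Δ)) ^ r) ^ Fintype.card d * (2 / Δ) ^ r with hA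
  have hA0 : 0 ≤ A := by positivity
  set ε : ℝ := (W - A * D) / (1 + A) with hε
  have hε0 : 0 < ε := div_pos (by linarith) (by positivity)
  -- tails of `g` and of the `∂ᵢ^r g`
  have hT0 := tendsto_tsum_compl_freqBall_norm_mFourierCoeff g
  have hTi : ∀ i : d, ∀ᶠ N : ℕ in atTop, ∑' k : {k // k ∉ freqBall (d := d) N},
      ‖mFourierCoeff (EuclideanSpace.complexify ∘ (partialDeriv i)^[r] g) k‖ < ε :=
    fun i => (tendsto_tsum_compl_freqBall_norm_mFourierCoeff ((partialDeriv i)^[r] g)).eventually (gt_mem_nhds hε0)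
  have hall : ∀ᶠ N : ℕ in atTop, (∑' k : {k // k ∉ freqBall (d := d) N}, ‖mFourierCoeff (EuclideanSpace.complexify ∘ g) k‖ < ε) ∧
      ∀ i : d, ∑' k : {k // k ∉ freqBall (d := d) N}, ‖mFourierCoeff (EuclideanSpace.complexify ∘ (partialDeriv i)^[r] g) k‖ < ε :=
    (hT0.eventually (gt_mem_nhds hε0)).and (eventually_all.2 hTi)
  obtain ⟨N, hNg, hNi⟩ := hall.exists
  -- the truncation `P_N g` and its derivative bounds
  have hgi : Integrable g volume := hg.integrable
  have hcs : IsConjSymm (fun k => mFourierCoeff (EuclideanSpace.complexify ∘ g) k) := isConjSymm_mFourierCoeff hgi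
  have hD' : ∀ i z, ‖realTrigPoly (freqBall N) (fun k => (2 * Real.pi * Complex.I * (k i)) ^ r •
      mFourierCoeff (EuclideanSpace.complexify ∘ g) k) z‖ ≤ D + ε := by
    intro i z
    rw [realTrigPoly_deriv_coeff_eq_fourierTruncate_iterate hg i r N]
    have h1 := norm_sub_fourierTruncate_apply_le (isSmooth_iterate_partialDeriv hg i r) N z
    have h2 : ‖fourierTruncate N ((partialDeriv i)^[r] g) z‖ ≤ ‖((partialDeriv i)^[r] g) z‖ +
        ‖((partialDeriv i)^[r] g) z - fourierTruncate N ((partialDeriv i)^[r] g) z‖ := by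
      have := norm_sub_le (((partialDeriv i)^[r] g) z) (((partialDeriv i)^[r] g) z - fourierTruncate N ((partialDeriv i)^[r] g) z)
      rwa [sub_sub_cancel] at this
    linarith [hD i z, hNi i]
  obtain ⟨t, htc, ht⟩ := exists_realTrigPoly_cubeSupp_near_realTrigPoly K hΔ neg_mem_freqBall_of_mem hcs r hD'
  refine ⟨t, htc, fun x => ?_⟩
  have h1 := norm_sub_fourierTruncate_apply_le hg N x
  have h2 := ht x
  rw [← fourierTruncate_eq] at h2
  calc ‖g x - realTrigPoly (cubeSupp d (K + 2 * Δ)) t x‖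
      ≤ ‖g x - fourierTruncate N g x‖ + ‖fourierTruncate N g x - realTrigPoly (cubeSupp d (K + 2 * Δ)) t x‖ := norm_sub_le_norm_sub_add_norm_sub _ _ _
    _ ≤ ε + A * (D + ε) := add_le_add (by linarith) (by rw [hA]; exact h2)
    _ = W := by rw [hε]; field_simp; ring

end Smooth

/-! ## §3 Read-out from the analyticity seminorm -/

section Dnorm

omit [Fintype d] in
/-- `∂ᵢ^r g = iterPartialDeriv (replicate r i) g`. [cite: ArmstrongVicol2025, App. A (A.1)] -/
theorem iterate_partialDeriv_eq_iterPartialDeriv {F : Type*} [NormedAddCommGroup F] [NormedSpace ℝ F]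
    (g : UnitAddTorus d → F) (i : d) (r : ℕ) : (partialDeriv i)^[r] g = iterPartialDeriv (List.replicate r i) g := by
  induction r with
  | zero => rfl
  | succ r ih => rw [Function.iterate_succ_apply', ih, List.replicate_succ]; rfl

/-- **Read-out**: `⟦g⟧_{r,R} ≤ M` gives `‖∂ᵢ^r g‖_∞ ≤ M · r! · R^r` for every axis. [cite: ArmstrongVicol2025, App. A (A.1)] -/
theorem norm_iterate_partialDeriv_le_of_dnorm_le {g : UnitAddTorus d → EuclideanSpace ℝ d} (hg : IsSmooth g) {r : ℕ} {R M : ℝ}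
    (hR : 0 < R) (hM : dnorm r R g ≤ M) (i : d) (z : UnitAddTorus d) :
    ‖((partialDeriv i)^[r] g) z‖ ≤ M * (Nat.factorial r : ℝ) * R ^ r := by
  have hM0 : 0 ≤ M := (dnorm_nonneg r hR.le g).trans hM
  have h := norm_iterPartialDeriv_le_of_dnorm_le hg hR hM (l := List.replicate r i) (List.length_replicate) z
  rw [← iterate_partialDeriv_eq_iterPartialDeriv] at h
  refine h.trans ?_
  rw [mul_assoc, mul_div_assoc]
  refine mul_le_mul_of_nonneg_left ?_ hM0
  refine div_le_self (by positivity) ?_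
  have : (1 : ℝ) ≤ (r : ℝ) + 1 := by linarith [(Nat.cast_nonneg r : (0:ℝ) ≤ r)]
  nlinarith

end Dnorm


/-! ## §4 Analytic fields: the exponential rate `e^{−Δ/(C R)}` -/

section Analytic

open EuclideanSpace

/-- Arithmetic of the optimisation over the order `r`: with `r = ⌊Δ/(4e·21^d·R)⌋`,
`d (1+(1+C_κ)^r)^d (2/Δ)^r · M r! R^r ≤ d 2^d e · M · exp(−Δ/(4e·21^d·R))` whenever `C_κ ≤ 20`. [cite: DeVoreLorentz1993, Ch. 7 §2] -/
theorem jackson_rate_bound {Cκ Δ R M : ℝ} (hC0 : 0 ≤ Cκ) (hC : Cκ ≤ 20) (hΔ : 0 < Δ) (hR : 0 < R) (hM : 0 ≤ M) (n : ℕ) :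
    let r : ℕ := ⌊Δ / (4 * Real.exp 1 * 21 ^ n * R)⌋₊
    (n : ℝ) * (1 + (1 + Cκ) ^ r) ^ n * (2 / Δ) ^ r * (M * (Nat.factorial r : ℝ) * R ^ r) ≤
      n * 2 ^ n * Real.exp 1 * M * Real.exp (-(Δ / (4 * Real.exp 1 * 21 ^ n * R))) := by
  intro r
  have he : 0 < Real.exp 1 := Real.exp_pos 1
  have h21 : (0 : ℝ) < 21 ^ n := by positivity
  set L : ℝ := Δ / (4 * Real.exp 1 * 21 ^ n * R) with hL
  have hL0 : 0 ≤ L := by positivity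
  have hrL : (r : ℝ) ≤ L := Nat.floor_le hL0
  have hLr : L < r + 1 := Nat.lt_floor_add_one L
  -- `1 + (1+Cκ)^r ≤ 2 · 21^r`
  have h1 : 1 + (1 + Cκ) ^ r ≤ 2 * 21 ^ r := by
    have : (1 + Cκ) ^ r ≤ 21 ^ r := pow_le_pow_left₀ (by linarith) (by linarith) r
    have h1r : (1 : ℝ) ≤ 21 ^ r := one_le_pow₀ (by norm_num)
    linarith
  have h2 : (1 + (1 + Cκ) ^ r) ^ n ≤ (2 * 21 ^ r) ^ n := pow_le_pow_left₀ (by positivity) h1 n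
  -- `r! ≤ r^r`
  have h3 : (Nat.factorial r : ℝ) ≤ (r : ℝ) ^ r := by exact_mod_cast Nat.factorial_le_pow r
  -- the geometric quantity `q = 21^n · 2 R r / Δ ≤ 1/(2e)`
  set q : ℝ := 21 ^ n * (2 * R * r / Δ) with hq
  have hq0 : 0 ≤ q := by positivity
  have hqe : q ≤ (Real.exp 1)⁻¹ := by
    rw [hq]
    have : 21 ^ n * (2 * R * (r : ℝ) / Δ) ≤ 21 ^ n * (2 * R * L / Δ) := by gcongr
    refine this.trans ?_
    have e : (21 : ℝ) ^ n * (2 * R * L / Δ) = (Real.exp 1)⁻¹ / 2 := by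
      rw [hL]; field_simp; ring
    rw [e]
    exact half_le_self (by positivity)
  -- assemble: LHS ≤ n 2^n M q^r
  have hkey : (1 + (1 + Cκ) ^ r) ^ n * (2 / Δ) ^ r * ((Nat.factorial r : ℝ) * R ^ r) ≤ 2 ^ n * q ^ r := by
    calc (1 + (1 + Cκ) ^ r) ^ n * (2 / Δ) ^ r * ((Nat.factorial r : ℝ) * R ^ r)
        ≤ (2 * 21 ^ r) ^ n * (2 / Δ) ^ r * ((r : ℝ) ^ r * R ^ r) := by
          gcongr
      _ = 2 ^ n * q ^ r := by
          rw [hq]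
          field_simp
          ring
  have hqr : q ^ r ≤ Real.exp (-(r : ℝ)) := by
    calc q ^ r ≤ ((Real.exp 1)⁻¹) ^ r := pow_le_pow_left₀ hq0 hqe r
      _ = Real.exp (-(r : ℝ)) := by rw [← Real.exp_neg, ← Real.exp_nat_mul]; ring_nf
  have hexp : Real.exp (-(r : ℝ)) ≤ Real.exp 1 * Real.exp (-L) := by
    rw [← Real.exp_add]; exact Real.exp_le_exp.2 (by linarith)
  calc (n : ℝ) * (1 + (1 + Cκ) ^ r) ^ n * (2 / Δ) ^ r * (M * (Nat.factorial r : ℝ) * R ^ r)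
      = n * M * ((1 + (1 + Cκ) ^ r) ^ n * (2 / Δ) ^ r * ((Nat.factorial r : ℝ) * R ^ r)) := by ring
    _ ≤ n * M * (2 ^ n * q ^ r) := mul_le_mul_of_nonneg_left hkey (by positivity)
    _ ≤ n * M * (2 ^ n * (Real.exp 1 * Real.exp (-L))) :=
        mul_le_mul_of_nonneg_left (mul_le_mul_of_nonneg_left (hqr.trans hexp) (by positivity)) (by positivity)
    _ = n * 2 ^ n * Real.exp 1 * M * Real.exp (-L) := by ring

/-- **CUBE JACKSON FOR ANALYTIC FIELDS — the exponential rate.**  If `g` is smooth with all Armstrong–Vicol seminorms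
`⟦g⟧_{n,R} ≤ M` (`R > 0`), then for `0 < Δ`, `K ≤ Δ` and every `W > d 2^d e · M · exp(−Δ/(4e·21^d·R))` there is a conjugate-symmetric
coefficient family `t` on the cube `‖k‖_∞ ≤ K + 2Δ` with `‖g − realTrigPoly (cubeSupp (K+2Δ)) t‖_∞ ≤ W`: the distance of an analytic field
to the cube-band-limited polynomials at scale `Δ` decays like `e^{−Δ/(CR)}` with NO power of `Δ`, `K`, `R` in front.
[cite: DeVoreLorentz1993, Ch. 7 §2] [cite: ArmstrongVicol2025, App. A (A.1)] -/
theorem exists_realTrigPoly_cubeSupp_near_of_dnorm_le {K Δ : ℕ} (hΔ : 0 < Δ) (hKΔ : K ≤ Δ)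
    {g : UnitAddTorus d → EuclideanSpace ℝ d} (hg : IsSmooth g) {R M : ℝ} (hR : 0 < R) (hM0 : 0 ≤ M)
    (hM : ∀ n, dnorm n R g ≤ M) {W : ℝ}
    (hW : Fintype.card d * 2 ^ Fintype.card d * Real.exp 1 * M *
      Real.exp (-((Δ : ℝ) / (4 * Real.exp 1 * 21 ^ Fintype.card d * R))) < W) :
    ∃ t : (d → ℤ) → EuclideanSpace ℂ d, IsConjSymm t ∧ ∀ x, ‖g x - realTrigPoly (cubeSupp d (K + 2 * Δ)) t x‖ ≤ W := by
  have hΔ0 : (0 : ℝ) < Δ := by exact_mod_cast hΔ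
  set r : ℕ := ⌊(Δ : ℝ) / (4 * Real.exp 1 * 21 ^ Fintype.card d * R)⌋₊ with hr
  have hD : ∀ i z, ‖((partialDeriv i)^[r] g) z‖ ≤ M * (Nat.factorial r : ℝ) * R ^ r :=
    fun i z => norm_iterate_partialDeriv_le_of_dnorm_le hg hR (hM r) i z
  -- the kernel constant `C_κ = 4 + (2K+2Δ+1)π/Δ ≤ 4 + 5π ≤ 20`
  set Cκ : ℝ := 4 + (2 * ((K : ℝ) + Δ) + 1) * Real.pi / Δ with hCκ
  have hC0 : 0 ≤ Cκ := by positivity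
  have hC : Cκ ≤ 20 := by
    have hK : (K : ℝ) ≤ Δ := by exact_mod_cast hKΔ
    have h1 : (1 : ℝ) ≤ Δ := by exact_mod_cast hΔ
    have h2 : (2 * ((K : ℝ) + Δ) + 1) * Real.pi / Δ ≤ 5 * Real.pi := by
      rw [div_le_iff₀ hΔ0]; nlinarith [Real.pi_pos]
    have := Real.pi_lt_d2  -- π < 3.15
    rw [hCκ]; nlinarith
  have hrate := jackson_rate_bound hC0 hC hΔ0 hR hM0 (Fintype.card d)
  simp only at hrate
  refine exists_realTrigPoly_cubeSupp_near_of_isSmooth K hΔ hg r hD (lt_of_le_of_lt ?_ hW)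
  have e : (4 + (2 * ((K : ℝ) + (Δ : ℕ)) + 1) * Real.pi / (Δ : ℕ)) = Cκ := by rw [hCκ]
  rw [e]
  exact hrate

end Analytic

end Torus
end Literature.Analysis.FunctionSpaces

end
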